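import Summits.QuantumAdvantage.QuantumAdvantage.Theorems.SteerDialFold

/-!
# SteerDial (2/7): SteerDialWords

§G — indicator algebra over `𝔽₃` (degree bookkeeping for folded strategies: `indPoly`, `lvl`, products/compositions
stay low-degree) and §W — the three certified identity words `W0 W1 W2` of length 6 (one per weight class mod 3), the
canonical certificate data `cα cβ ca cb`, `wordCert_of_idWord6`, `card_idWord6 = 11`.

Part 2 of 7 of the prover-side twin of the workshop node «SteerDial» (route `SpreadDial`, node on 29065 `CoverLift3`;
lineage decomp-qadv-lens-5, generation 7).  Content verbatim from the monolithic twin `tree/SpreadDialSteer.lean`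
(sha256 5f501baf…, farm rc0 · 0 err · 0 warn · 0 sorry; axioms `propext`/`Classical.choice`/`Quot.sound` for every theorem),
cut at section boundaries to meet the 400-line rule.  No `def … : Prop`, no `instance`, no `notation`.
-/

set_option linter.style.longLine false
set_option linter.dupNamespace false

namespace Summit.QuantumAdvantage.QuantumAdvantage.Theorems.SteerDial

open Finset
open Literature.Computability.QuantumComplexity Literature.Computability.MetaComplexity
open Literature.Computability.QuantumComplexity.RingHLF
open Summit.QuantumAdvantage.AdviceFreeQNC0
open Summit.QuantumAdvantage.QuantumAdvantage.Theses

/-! ## §G  Indicator algebra over `𝔽₃` (degree bookkeeping for folded strategies) -/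

section Indicator
variable {n : ℕ}

/-- The `{0,1}`-valued `𝔽₃`-function of a Boolean function on the cube. -/
def ind (f : (Fin n → Bool) → Bool) : Smolensky.CubeFn (ZMod 3) n := fun y => if f y then 1 else 0

/-- SteerDial helper `decide_ind_eq_one` (lens-5 g7 SteerDial twin; see the enclosing section docstring). -/
@[simp] theorem decide_ind_eq_one (f : (Fin n → Bool) → Bool) (y : Fin n → Bool) : decide (ind f y = 1) = f y := by
  unfold ind; cases f y <;> decide

/-- SteerDial helper `one_mem_lowDeg` (lens-5 g7 SteerDial twin; see the enclosing section docstring). -/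
theorem one_mem_lowDeg (d : ℕ) : (1 : Smolensky.CubeFn (ZMod 3) n) ∈ Smolensky.lowDeg (ZMod 3) n d := by
  rw [← Smolensky.mono_empty]; exact Smolensky.mono_mem_lowDeg (by simp)

/-- The output bit `[Q = 1]` of a degree-`d` polynomial is the degree-`2d` polynomial `1 - (Q-1)²`. -/
theorem ind_decide_mem_lowDeg {d : ℕ} {Q : Smolensky.CubeFn (ZMod 3) n} (hQ : Q ∈ Smolensky.lowDeg (ZMod 3) n d) :
    ind (fun y => decide (Q y = 1)) ∈ Smolensky.lowDeg (ZMod 3) n (2 * d) := by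
  have key : ∀ a : ZMod 3, (if a = 1 then (1 : ZMod 3) else 0) = 1 - (a - 1) * (a - 1) := by decide
  have h : ind (fun y => decide (Q y = 1)) = 1 - (Q - 1) * (Q - 1) := by
    funext y
    simp only [ind, Pi.sub_apply, Pi.mul_apply, Pi.one_apply, decide_eq_true_eq]
    exact key (Q y)
  rw [h, two_mul]
  exact Submodule.sub_mem _ (one_mem_lowDeg _)
    (Smolensky.mul_mem_lowDeg_add (Submodule.sub_mem _ hQ (one_mem_lowDeg _)) (Submodule.sub_mem _ hQ (one_mem_lowDeg _)))

/-- SteerDial helper `ind_xor` (lens-5 g7 SteerDial twin; see the enclosing section docstring). -/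
theorem ind_xor (f g : (Fin n → Bool) → Bool) :
    ind (fun y => xor (f y) (g y)) = ind f + ind g + ind f * ind g := by
  have key : ∀ a b : Bool, (if (xor a b) = true then (1 : ZMod 3) else 0) =
      ((if a = true then 1 else 0) + (if b = true then 1 else 0)) + (if a = true then 1 else 0) * (if b = true then 1 else 0) := by
    decide
  funext y
  simp only [ind, Pi.add_apply, Pi.mul_apply]
  exact key (f y) (g y)

/-- SteerDial helper `ind_xor_mem_lowDeg` (lens-5 g7 SteerDial twin; see the enclosing section docstring). -/
theorem ind_xor_mem_lowDeg {df dg : ℕ} {f g : (Fin n → Bool) → Bool} (hf : ind f ∈ Smolensky.lowDeg (ZMod 3) n df)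
    (hg : ind g ∈ Smolensky.lowDeg (ZMod 3) n dg) :
    ind (fun y => xor (f y) (g y)) ∈ Smolensky.lowDeg (ZMod 3) n (df + dg) := by
  rw [ind_xor]
  exact Submodule.add_mem _ (Submodule.add_mem _ (Smolensky.lowDeg_mono (Nat.le_add_right _ _) hf)
    (Smolensky.lowDeg_mono (Nat.le_add_left _ _) hg)) (Smolensky.mul_mem_lowDeg_add hf hg)

/-- SteerDial helper `ind_const_mem_lowDeg` (lens-5 g7 SteerDial twin; see the enclosing section docstring). -/
theorem ind_const_mem_lowDeg (a : Bool) (d : ℕ) : ind (fun _ : Fin n → Bool => a) ∈ Smolensky.lowDeg (ZMod 3) n d := by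
  cases a
  · have h : ind (fun _ : Fin n → Bool => false) = 0 := by funext y; simp [ind]
    rw [h]; exact Submodule.zero_mem _
  · have h : ind (fun _ : Fin n → Bool => true) = 1 := by funext y; simp [ind]
    rw [h]; exact one_mem_lowDeg _

/-- Parity of a family of bits of degree `≤ d` each has degree `≤ |S|·d`. -/
theorem ind_parity_mem_lowDeg {ι : Type*} [DecidableEq ι] (S : Finset ι) (Zb : ι → (Fin n → Bool) → Bool) (d : ℕ)
    (h : ∀ j ∈ S, ind (Zb j) ∈ Smolensky.lowDeg (ZMod 3) n d) :
    ind (fun y => decide ((S.filter fun j => Zb j y = true).card % 2 = 1)) ∈ Smolensky.lowDeg (ZMod 3) n (S.card * d) := by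
  induction S using Finset.induction_on with
  | empty => simpa using ind_const_mem_lowDeg (n := n) false 0
  | @insert j S hj ih =>
    have hfun : (fun y => decide (((insert j S).filter fun j' => Zb j' y = true).card % 2 = 1)) =
        fun y => xor (Zb j y) (decide ((S.filter fun j' => Zb j' y = true).card % 2 = 1)) := by
      funext y
      rw [Finset.filter_insert]
      cases hZ : Zb j y
      · simp
      · rw [if_pos rfl, Finset.card_insert_of_notMem (fun hm => hj (Finset.mem_filter.1 hm).1)]
        rcases Nat.mod_two_eq_zero_or_one (S.filter fun j' => Zb j' y = true).card with h0 | h1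
        · simp [h0, Nat.add_mod]
        · simp [h1, Nat.add_mod]
    rw [hfun, Finset.card_insert_of_notMem hj, Nat.succ_mul, Nat.add_comm]
    exact ind_xor_mem_lowDeg (h j (Finset.mem_insert_self _ _)) (ih fun j' hj' => h j' (Finset.mem_insert_of_mem hj'))

/-- The Hamming level `|y| mod 3` as an element of `𝔽₃`. -/
def lvl (y : Fin n → Bool) : ZMod 3 := ∑ i, (if y i then (1 : ZMod 3) else 0)

/-- `|·| mod 3` is the degree-1 polynomial `Σ xᵢ`. -/
theorem lvl_mem_lowDeg : (fun y : Fin n → Bool => lvl y) ∈ Smolensky.lowDeg (ZMod 3) n 1 := by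
  have h : (fun y : Fin n → Bool => lvl y) = ∑ i : Fin n, Smolensky.mono (ZMod 3) {i} := by
    funext y
    simp only [lvl, Finset.sum_apply, Smolensky.mono_apply, Finset.mem_singleton, forall_eq]
  rw [h]
  exact Submodule.sum_mem _ fun i _ => Smolensky.mono_mem_lowDeg (by simp)

/-- The level selector `[|y| ≡ t]` has degree 2. -/
theorem ind_lvl_mem_lowDeg (t : ZMod 3) : ind (fun y : Fin n → Bool => decide (lvl y = t)) ∈ Smolensky.lowDeg (ZMod 3) n 2 := by
  have h : ind (fun y : Fin n → Bool => decide (lvl y = t)) =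
      ind (fun y => decide (((fun y : Fin n → Bool => lvl y) - (t - 1) • (1 : Smolensky.CubeFn (ZMod 3) n)) y = 1)) := by
    funext y
    simp only [ind, Pi.sub_apply, Pi.smul_apply, Pi.one_apply, smul_eq_mul, mul_one]
    have e : (lvl y = t) ↔ (lvl y - (t - 1) = 1) := by
      constructor
      · intro h; rw [h]; ring
      · intro h; linear_combination h
    simp only [e]
  have h2 := ind_decide_mem_lowDeg (n := n) (d := 1)
    (Q := (fun y : Fin n → Bool => lvl y) - (t - 1) • (1 : Smolensky.CubeFn (ZMod 3) n))
    (Submodule.sub_mem _ lvl_mem_lowDeg (Submodule.smul_mem _ _ (one_mem_lowDeg _)))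
  rw [h]
  exact Smolensky.lowDeg_mono (le_of_eq (by norm_num)) h2

/-- SteerDial helper `lvl_pad` (lens-5 g7 SteerDial twin; see the enclosing section docstring). -/
theorem lvl_pad {m : ℕ} (w : Fin m → Bool) (y : Fin n → Bool) : lvl (pad w y) = lvl y + lvl w := by
  unfold lvl
  rw [Fin.sum_univ_add]
  simp only [pad_castAdd, pad_natAdd]

end Indicator

/-! ## §W  Three identity words of length 6, one of each weight mod 3, with `decide`d certificates -/

section Words

/-- `000000` (weight 0). -/
def W0 : Fin 6 → Bool := ![false, false, false, false, false, false]
/-- `011011` (weight 4 ≡ 1). -/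
def W1 : Fin 6 → Bool := ![false, true, true, false, true, true]
/-- `000101` (weight 2). -/
def W2 : Fin 6 → Bool := ![false, false, false, true, false, true]

/-- `u`-table first row (`α`) of the certificate of `W0`. -/
def A0 : Fin 6 → Bool := ![false, true, false, true, false, true]
/-- `u`-table second row (`β`) of the certificate of `W0`. -/
def B0 : Fin 6 → Bool := ![true, false, true, false, true, false]
/-- `u`-table first row (`α`) of the certificate of `W1`. -/
def A1 : Fin 6 → Bool := ![false, true, true, false, true, true]
/-- `u`-table second row (`β`) of the certificate of `W1`. -/
def B1 : Fin 6 → Bool := ![true, false, true, true, true, false]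
/-- `u`-table first row (`α`) of the certificate of `W2`. -/
def A2 : Fin 6 → Bool := ![false, true, false, true, true, true]
/-- `u`-table second row (`β`) of the certificate of `W2`. -/
def B2 : Fin 6 → Bool := ![true, false, true, false, true, false]

/-- The word of weight `≡ ρ (mod 3)` and its certificate data. -/
def wsel (ρ : ZMod 3) : Fin 6 → Bool := if ρ = 0 then W0 else if ρ = 1 then W1 else W2
/-- Word-selected `α`-row: `αsel ρ` is the `α`-certificate of `wsel ρ`. -/
def αsel (ρ : ZMod 3) : Fin 6 → Bool := if ρ = 0 then A0 else if ρ = 1 then A1 else A2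
/-- Word-selected `β`-row: `βsel ρ` is the `β`-certificate of `wsel ρ`. -/
def βsel (ρ : ZMod 3) : Fin 6 → Bool := if ρ = 0 then B0 else if ρ = 1 then B1 else B2
/-- Word-selected `λ`-bit `a` of `wsel ρ`. -/
def asel (ρ : ZMod 3) : Bool := decide (ρ = 2)
/-- Word-selected `λ`-bit `b` of `wsel ρ`. -/
def bsel (ρ : ZMod 3) : Bool := decide (ρ = 1)

/-- The three certificates (identity word, linear block trajectory, even block overlap, linear sign flip). -/
theorem wordCert_W0 : wordCert W0 A0 B0 false false = true := by decide +kernel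
/-- SteerDial helper `wordCert_W1` (lens-5 g7 SteerDial twin; see the enclosing section docstring). -/
theorem wordCert_W1 : wordCert W1 A1 B1 false true = true := by decide +kernel
/-- SteerDial helper `wordCert_W2` (lens-5 g7 SteerDial twin; see the enclosing section docstring). -/
theorem wordCert_W2 : wordCert W2 A2 B2 true false = true := by decide +kernel

/-- SteerDial helper `wordCert_sel` (lens-5 g7 SteerDial twin; see the enclosing section docstring). -/
theorem wordCert_sel (ρ : ZMod 3) : wordCert (wsel ρ) (αsel ρ) (βsel ρ) (asel ρ) (bsel ρ) = true := by
  fin_cases ρ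
  · exact wordCert_W0
  · exact wordCert_W1
  · exact wordCert_W2

/-- The selected word has the selected weight mod 3. -/
theorem lvl_wsel : ∀ ρ : ZMod 3, lvl (wsel ρ) = ρ := by
  decide +kernel

/-- The CANONICAL certificate data of a word (determined by the word alone): the block trajectories from the two basis
states `(1,0)`, `(0,1)` and the two sign-flip bits read off the block statistics at those states. -/
def cα {m : ℕ} (w : Fin m → Bool) : Fin m → Bool := kernelVec w (true, false)
/-- Canonical `β`-row of a word: the trajectory of the state `(0,1)`. -/
def cβ {m : ℕ} (w : Fin m → Bool) : Fin m → Bool := kernelVec w (false, true)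
/-- Canonical `λ`-bit `a` of a word: `λ(1,0) = (blockEdges + blockAnd/2)(1,0) mod 2`. -/
def ca {m : ℕ} (w : Fin m → Bool) : Bool := decide ((blockEdges w (true, false) + blockAnd w (true, false) / 2) % 2 = 1)
/-- Canonical `λ`-bit `b` of a word: `λ(0,1) = (blockEdges + blockAnd/2)(0,1) mod 2`. -/
def cb {m : ℕ} (w : Fin m → Bool) : Bool := decide ((blockEdges w (false, true) + blockAnd w (false, true) / 2) % 2 = 1)

/-- **Every identity word of length 6 is certified by its canonical data** (kernel decision over all 64 words; the
eleven identity words are `000000 111111 · 011011 101101 110110 · 000101 001010 010001 010100 100010 101000`). -/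
theorem wordCert_of_idWord6 : ∀ w : Fin 6 → Bool, idWord w = true → wordCert w (cα w) (cβ w) (ca w) (cb w) = true := by
  decide +kernel

/-- **The identity words of length 6 (`T_w = 1`) are exactly eleven** — 2 of weight `≡ 0`, 3 of weight `≡ 1`, 6 of weight
`≡ 2 (mod 3)`. -/
theorem card_idWord6 : (univ.filter fun w : Fin 6 → Bool => ∀ s : St, monodromy (List.ofFn w) s = s).card = 11 := by
  decide +kernel

/-- SteerDial helper `card_idWord6_lvl` (lens-5 g7 SteerDial twin; see the enclosing section docstring). -/
theorem card_idWord6_lvl :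
    (univ.filter fun w : Fin 6 → Bool => (∀ s : St, monodromy (List.ofFn w) s = s) ∧ lvl w = 0).card = 2 ∧
    (univ.filter fun w : Fin 6 → Bool => (∀ s : St, monodromy (List.ofFn w) s = s) ∧ lvl w = 1).card = 3 ∧
    (univ.filter fun w : Fin 6 → Bool => (∀ s : St, monodromy (List.ofFn w) s = s) ∧ lvl w = 2).card = 6 := by
  refine ⟨?_, ?_, ?_⟩ <;> decide +kernel

end Words

end Summit.QuantumAdvantage.QuantumAdvantage.Theorems.SteerDial
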